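import Summits.ValiantsHypothesis.ValiantsHypothesis.Theorems.MonotoneRestorationOrbitRestorationQPPermanentOutsideRung
import HarnessLib

/-!
# Route MonotoneRestoration — crux `OrbitRestorationQP` (stmt-ValiantsHypothesis-18293), line `depth-three-rung`:
# no `VP`-complete family is in the rung's hypothesis class (companion of `…PermanentOutsideRung.lean`)

`Theorems/…PermanentOutsideRung.lean` proves, unconditionally, that no family into which the iterated matrix
multiplication polynomials `IMM_{n,d}` project with polynomial blow-up lies in the `ΣΠΣ` slice `PDClass (fun _ => 1) · c`
(`not_pdClassOne_of_immProjection`, from the in-tree LST Cor. 4), and derives `perPoly_not_pdClassOne`,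
`not_pdClassOne_of_perProjection`, `not_isVNPComplete_of_pdClassOne`.  This companion (split off for the 400-line rule)
abstracts the projection step and adds the `VP`-complete version BY NAME:

* `immProjection_of_forall_isVPFamily` — if every `VP` family on `Fin`-indexed variables is a p-projection of `F`, then
  `IMM_{n,d}` is a projection of `F m` with `m ≤ (n + d + 2)^a` (the universal `IMM` family `N ↦ IMM_{unpair N}` is `VP`);
* `not_isVPComplete_of_pdClassOne` — a family in `PDClass 1 · c` is not `IsVPComplete`.

So the hypothesis class of the rung `A_∞` (`stub_sigmaPiSigmaValue`) contains no complete family of `VP` or `VNP`; a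
counterexample to the rung is complete for neither.  Calibration only; no stub moves; VP ≠ VNP untouched.
[cite: LimayeSrinivasanTavenas2021, Cor. 4; Burgisser2000, Def. 2.8]
-/

noncomputable section

open scoped Classical

-- `Summit.ValiantsHypothesis.ValiantsHypothesis.…` is the tree's single-conjunct layout (Sub = Summit).
set_option linter.dupNamespace false

namespace Summit.ValiantsHypothesis.ValiantsHypothesis.Theorems.OrbitRestorationQPDepthThreeRung

namespace PermanentOutsideRung

open Literature.Computability.AlgebraicComplexity MvPolynomial

/-! ### No `VP`-complete family has polynomial `ΣΠΣ` circuits over `ℂ` -/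

/-- **The universal `IMM` family tests hardness.**  If every `VP` family on `Fin`-indexed variables is a p-projection of
`F` (e.g. `F` is `VP`-complete or `VNP`-complete), then `IMM_{n,d}` is a projection of `F m` with `m ≤ (n + d + 2)^a`:
the universal family `N ↦ IMM_{(unpair N).1,(unpair N).2}` (renamed to `Fin (d n²)` variables) is a `VP` family, read at
`N = pair n d`. (Same computation as `perPoly_immProjection`, with the projection hypothesis abstracted.)
[cite: Burgisser2000, Def. 2.6 and Def. 2.8; KumarSaraf2017, §3] -/
theorem immProjection_of_forall_isVPFamily (F : (m : ℕ) → MvPolynomial (Fin m × Fin m) ℂ)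
    (hF : ∀ (v : ℕ → ℕ) (g : ∀ n, MvPolynomial (Fin (v n)) ℂ), IsVPFamily g → IsPProjection g F) :
    ∃ a : ℕ, ∀ n d : ℕ, ∃ m : ℕ, m ≤ (n + d + 2) ^ a ∧ IsProjection (immPoly n d ℂ) (F m) := by
  let g : (N : ℕ) → MvPolynomial
      (Fin (Fintype.card (Fin (Nat.unpair N).2 × Fin (Nat.unpair N).1 × Fin (Nat.unpair N).1))) ℂ :=
    fun N => rename (Fintype.equivFin (Fin (Nat.unpair N).2 × Fin (Nat.unpair N).1 × Fin (Nat.unpair N).1))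
      (immPoly (Nat.unpair N).1 (Nat.unpair N).2 ℂ)
  have hgVP : IsVPFamily g := by
    refine ⟨⟨⟨3, fun N => ?_⟩, ⟨1, fun N => ?_⟩⟩, ⟨5, fun N => ?_⟩⟩
    · have h1 := Nat.unpair_left_le N
      have h2 := Nat.unpair_right_le N
      simp only [Fintype.card_fin, Fintype.card_prod]
      calc (Nat.unpair N).2 * ((Nat.unpair N).1 * (Nat.unpair N).1) ≤ N * (N * N) :=
            Nat.mul_le_mul h2 (Nat.mul_le_mul h1 h1)
        _ = N ^ 3 := by ring
        _ ≤ N ^ 3 + 3 := Nat.le_add_right _ _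
    · calc (g N).totalDegree ≤ (immPoly (Nat.unpair N).1 (Nat.unpair N).2 ℂ).totalDegree :=
            totalDegree_rename_le _ _
        _ ≤ (Nat.unpair N).2 := (immPoly_isHomogeneous_holds (k := ℂ) _ _).totalDegree_le
        _ ≤ N := Nat.unpair_right_le N
        _ ≤ N ^ 1 + 1 := by rw [pow_one]; omega
    · have h1 := Nat.unpair_left_le N
      have h2 := Nat.unpair_right_le N
      calc complexity (g N) ≤ complexity (immPoly (Nat.unpair N).1 (Nat.unpair N).2 ℂ) :=
            complexity_rename_le_holds' _ _
        _ ≤ (Nat.unpair N).1 + 2 * (Nat.unpair N).1 ^ 3 * (Nat.unpair N).2 := complexity_immPoly_le ℂ _ _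
        _ ≤ N + 2 * N ^ 3 * N :=
            Nat.add_le_add h1 (Nat.mul_le_mul (Nat.mul_le_mul_left 2 (Nat.pow_le_pow_left h1 3)) h2)
        _ ≤ N ^ 5 + 5 := by
            rcases Nat.lt_or_ge N 3 with hN | hN
            · interval_cases N <;> norm_num
            · have hN4 : N ≤ N ^ 4 := Nat.le_self_pow (by norm_num) N
              have hN5 : 3 * N ^ 4 ≤ N ^ 5 := by
                calc 3 * N ^ 4 ≤ N * N ^ 4 := Nat.mul_le_mul_right _ hN
                  _ = N ^ 5 := by ring
              nlinarith
  obtain ⟨t, ⟨a, hta⟩, hproj⟩ := hF _ g hgVP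
  refine ⟨2 * a + 1, fun n d => ⟨t (Nat.pair n d), ?_, ?_⟩⟩
  · have hY2 : 2 ≤ n + d + 2 := by omega
    have hpair : Nat.pair n d ≤ (n + d + 2) ^ 2 :=
      (Nat.pair_lt_max_add_one_sq n d).le.trans (Nat.pow_le_pow_left (by omega) 2)
    calc t (Nat.pair n d) ≤ (Nat.pair n d) ^ a + a := hta _
      _ ≤ ((n + d + 2) ^ 2) ^ a + (n + d + 2) ^ a :=
          Nat.add_le_add (Nat.pow_le_pow_left hpair a)
            (Nat.lt_two_pow_self.le.trans (Nat.pow_le_pow_left hY2 a))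
      _ ≤ (n + d + 2) ^ (2 * a) + (n + d + 2) ^ (2 * a) := by
          rw [← pow_mul]
          exact Nat.add_le_add le_rfl (Nat.pow_le_pow_right (by omega) (by omega))
      _ = 2 * (n + d + 2) ^ (2 * a) := by ring
      _ ≤ (n + d + 2) * (n + d + 2) ^ (2 * a) := Nat.mul_le_mul_right _ hY2
      _ = (n + d + 2) ^ (2 * a + 1) := by ring
  · have h := isProjection_rename (hproj (Nat.pair n d))
      (Fintype.equivFin (Fin (Nat.unpair (Nat.pair n d)).2 × Fin (Nat.unpair (Nat.pair n d)).1 ×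
        Fin (Nat.unpair (Nat.pair n d)).1)).symm
    have hgg : rename (Fintype.equivFin (Fin (Nat.unpair (Nat.pair n d)).2 × Fin (Nat.unpair (Nat.pair n d)).1 ×
        Fin (Nat.unpair (Nat.pair n d)).1)).symm (g (Nat.pair n d)) =
        immPoly (Nat.unpair (Nat.pair n d)).1 (Nat.unpair (Nat.pair n d)).2 ℂ := by
      simp only [g]
      rw [rename_rename, Equiv.symm_comp_self, rename_id_apply]
    rw [hgg] at h
    rw [Nat.unpair_pair] at h
    exact h

/-- **NO `VP`-COMPLETE FAMILY IS IN THE RUNG'S HYPOTHESIS CLASS** (the tree's `IsVPComplete`, by name): a family in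
`PDClass (fun _ => 1) · c` is not `VP`-complete under p-projections — `IMM` would project onto it polynomially
(`immProjection_of_forall_isVPFamily`), contradicting `not_pdClassOne_of_immProjection`.  With
`not_isVNPComplete_of_pdClassOne`: the rung's hypothesis class contains no complete family of `VP` or `VNP`, so a
counterexample to `A_∞` is complete for neither. [cite: LimayeSrinivasanTavenas2021, Cor. 4; Burgisser2000, Def. 2.8] -/
theorem not_isVPComplete_of_pdClassOne {f : (n : ℕ) → MvPolynomial (Fin n × Fin n) ℂ}
    (hPD : ∃ c : ℕ, ∀ n : ℕ, PDClass (fun _ => 1) n c (f n)) : ¬ IsVPComplete f :=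
  fun hf => not_pdClassOne_of_immProjection f (immProjection_of_forall_isVPFamily f hf.2) hPD

end PermanentOutsideRung

end Summit.ValiantsHypothesis.ValiantsHypothesis.Theorems.OrbitRestorationQPDepthThreeRung

end
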